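/-
Copyright: the b2b-balaban T⁴-continuum CRUX team, row NE7b leaf lineage `t4-ne7b-formalise-leaf-03` (gen 140). Project licence.
-/
import Mathlib.Analysis.Calculus.LineDeriv.IntegrationByParts
import Mathlib.Analysis.Calculus.Gradient.Basic
import Mathlib.Analysis.Calculus.FDeriv.Measurable
import Mathlib.Analysis.InnerProductSpace.PiL2
import Mathlib.MeasureTheory.Measure.Haar.InnerProductSpace
import Mathlib.MeasureTheory.Measure.Tilted
import Mathlib.Algebra.QuadraticDiscriminant

/-!
# THE TILTED MEAN SITS WITHIN `√(n∕λ)` OF THE MINIMISER: the centring letter of the slab road from the virial identity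
# `∫ DV(x)[x − x₀]·e^{−V} = n·∫e^{−V}` (integration by parts) and strong monotonicity
# (row NE7b, node U5c; kernel lemmas of real analysis, Mathlib only)

Cell `pub-balaban`, sub-cell `t4`, spine estimate NE7b (`T4WeightBudget.RelWeightBound`; the cell's OWN estimate — NOT PRINTED in
[Bałaban 1983–89], NOT PROVED).  Crux-route work under `Spine/NE7b/` by a row leaf on the convexity road; NOTHING of Bałaban's is named
or asserted; no `T4Continuum/Support` leaf typed; no `def`; zero `sorry`.

WHY.  The slab-window `hmass` suppliers of the convexity road centre the window at the tilted MEDIANS (`…ConvexSlabWindowMedians`) or at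
the tilted MEANS `m_u = ∫⟪u, x⟫dν_V` (`…ConvexSlabWindowTiltedMeans`), whereas print's window is centred at ITS centre — read as the
minimiser `x₀` of the same globalised exponent `V` (PRICING-NE7b v80 F428 (σ4)).  The pricing desk's centring letter: «`|⟪u_i, mean − x₀⟫|
≤ (𝔼‖x − x₀‖²)^{½} ≤ √(d∕λ)` for `x₀` the minimiser of V (integrate `⟪∇V(x) − ∇V(x₀), x − x₀⟫ ≥ λ‖x − x₀‖²` against `e^{−V}`:
`𝔼⟪∇V(x), x − x₀⟫ = d` by parts)» (F428, «Supplier [folklore, two lines each]»).  THIS FILE types it: the by-parts step is Mathlib's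
whole-space integration by parts on a finite-dimensional space with Haar measure (`integral_mul_fderiv_eq_neg_fderiv_mul_of_integrable`,
no boundary terms: integrability of `f·g`, `f′·g`, `f·g′` instead), run once per coordinate direction and summed.

WHAT IS PROVED ([folklore]; `V : EuclideanSpace ℝ (Fin n) → ℝ` differentiable, `hV` = the road's first-order `λ`-convexity letter
verbatim, `x₀` a critical point `∇V x₀ = 0` — supplied by `…ConvexMinimiser` —, moment integrabilities DISPLAYED and supplied from the
two-sided letters in the companion `…TiltedMeanNearMinimiserSuppliers`):
§1 `integral_inner_mul_fderiv_mul_exp_neg` — `∫⟪v, x − x₀⟫·DV(x)[v]·e^{−V} = ‖v‖²·∫e^{−V}` (one direction, by parts).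
§2 `fderiv_apply_eq_sum_coord`, **`integral_fderiv_apply_sub_mul_exp_neg`** — the VIRIAL IDENTITY `∫DV(x)[x − x₀]·e^{−V} = n·∫e^{−V}`.
§3 `norm_sq_le_fderiv_apply_sub` (`λ‖x − x₀‖² ≤ DV(x)[x − x₀]` at a critical point), **`integral_norm_sq_mul_exp_neg_le`**
(`λ·∫‖x − x₀‖²e^{−V} ≤ n·∫e^{−V}`).
§4 `sq_integral_mul_le` (Cauchy–Schwarz against a weight, by the discriminant), `integral_norm_mul_exp_neg_le`
(`∫‖x − x₀‖e^{−V} ≤ √(n∕λ)·∫e^{−V}`), `abs_integral_inner_sub_mul_exp_neg_le`, `tiltedMean_inner_sub_eq` (`integral_tilted`), and the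
END **`abs_tiltedMean_inner_sub_le`**: `|∫⟪u, x⟫dν_V − ⟪u, x₀⟫| ≤ ‖u‖·√(n∕λ)`, `ν_V = e^{−V}dx∕∫e^{−V}` — the δ of F428's re-centring
(`δ = √(d∕λ)` per unit functional; with the medians' `1∕√λ`-type offsets the companions' `…_near` sockets take it BY VALUE).

NOT HERE (honest): that print's window centre IS the minimiser of the SAME globalised `V` whose measure is tilted ((A1c) ∕ (σ4): «if
print centres at the background's classical configuration rather than the effective action's minimiser, the difference is one more
displacement»); `λ`, `n` by value; anything of Bałaban's.  NE7b NOT PRINTED ∕ NOT PROVED; spine PROVED 0∕9; rung (B)+1 on a FINITE torus —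
NOT infinite volume, NOT the mass gap, NOT Clay.
HONEST DEPENDENCY: continuum YM on T⁴ ⇐ BetaPertH ∧ nine spine estimates (0/9 proved); BetaPertH ⇐ (D1) ∧ (D4) ∧ CAP+tail; G-an2-4
gates asym, D1 and NE2/3/4.
-/

set_option autoImplicit false

noncomputable section

open MeasureTheory Real InnerProductSpace
open scoped RealInnerProductSpace

namespace Summit.QuantumFields.BalabanUV.T4Continuum.NE7b.TiltedMeanNearMinimiser

variable {n : ℕ}

/-! ## §1 Integration by parts against `e^{−V}` along one direction -/

/-- **ONE-DIRECTIONAL VIRIAL IDENTITY**: for `V` differentiable with `e^{−V}` integrable and any `x₀, v`,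
`∫ ⟪v, x − x₀⟫ · DV(x)[v] · e^{−V x} dx = ‖v‖² · ∫ e^{−V}` — Mathlib's whole-space integration by parts
`integral_mul_fderiv_eq_neg_fderiv_mul_of_integrable` with `f = ⟪v, · − x₀⟫`, `g = e^{−V}`; the two products that must be integrable
are displayed. [folklore] -/
theorem integral_inner_mul_fderiv_mul_exp_neg {V : EuclideanSpace ℝ (Fin n) → ℝ} (hVd : Differentiable ℝ V)
    (x₀ v : EuclideanSpace ℝ (Fin n)) (hZ : Integrable fun x => exp (-V x))
    (hA : Integrable fun x => ⟪v, x - x₀⟫ * exp (-V x))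
    (hB : Integrable fun x => ⟪v, x - x₀⟫ * (fderiv ℝ V x v * exp (-V x))) :
    ∫ x, ⟪v, x - x₀⟫ * (fderiv ℝ V x v * exp (-V x)) = ‖v‖ ^ 2 * ∫ x, exp (-V x) := by
  set f : EuclideanSpace ℝ (Fin n) → ℝ := fun x => ⟪v, x - x₀⟫ with hf
  set g : EuclideanSpace ℝ (Fin n) → ℝ := fun x => exp (-V x) with hg
  -- derivatives
  have hfd : ∀ x, HasFDerivAt f (innerSL ℝ v) x := fun x => by
    have h := ((innerSL ℝ v).hasFDerivAt).comp x ((hasFDerivAt_id x).sub_const x₀)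
    simpa [hf, Function.comp_def] using h
  have hf' : ∀ x, fderiv ℝ f x v = ‖v‖ ^ 2 := fun x => by
    rw [(hfd x).fderiv, innerSL_apply_apply, real_inner_self_eq_norm_sq]
  have hgd : ∀ x, HasFDerivAt g (exp (-V x) • (-(fderiv ℝ V x))) x := fun x => by
    have h := ((hVd x).hasFDerivAt.neg).exp
    simpa [hg] using h
  have hg' : ∀ x, fderiv ℝ g x v = -(fderiv ℝ V x v * exp (-V x)) := fun x => by
    rw [(hgd x).fderiv]
    simp only [FunLike.coe_smul, FunLike.coe_neg, Pi.smul_apply, Pi.neg_apply, smul_eq_mul]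
    ring
  -- the three integrability hypotheses of the by-parts lemma
  have h1 : Integrable (fun x => fderiv ℝ f x v * g x) := by
    refine (hZ.const_mul (‖v‖ ^ 2)).congr (ae_of_all _ fun x => ?_)
    simp only [hf', hg]
  have h2 : Integrable (fun x => f x * fderiv ℝ g x v) := by
    refine hB.neg.congr (ae_of_all _ fun x => ?_)
    simp only [hf, hg', Pi.neg_apply, mul_neg]
  have h3 : Integrable (fun x => f x * g x) := hA
  have key := integral_mul_fderiv_eq_neg_fderiv_mul_of_integrable (μ := volume) h1 h2 h3
    (fun x _ => (hfd x).differentiableAt) (fun x _ => (hgd x).differentiableAt)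
  -- unpack
  have lhs : ∫ x, f x * fderiv ℝ g x v = -∫ x, ⟪v, x - x₀⟫ * (fderiv ℝ V x v * exp (-V x)) := by
    rw [← integral_neg]
    refine integral_congr_ae (ae_of_all _ fun x => ?_)
    simp only [hf, hg', mul_neg]
  have rhs : ∫ x, fderiv ℝ f x v * g x = ‖v‖ ^ 2 * ∫ x, exp (-V x) := by
    rw [← integral_const_mul]
    refine integral_congr_ae (ae_of_all _ fun x => ?_)
    simp only [hf', hg]
  rw [lhs, rhs] at key
  linarith

/-! ## §2 The virial identity `∫ DV(x)[x − x₀] e^{−V} = d·∫e^{−V}` -/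

/-- Expansion of the Fréchet derivative along the standard basis: `DV(x)[w] = Σ_i w_i · DV(x)[e_i]`. [folklore] -/
theorem fderiv_apply_eq_sum_coord {V : EuclideanSpace ℝ (Fin n) → ℝ} (x w : EuclideanSpace ℝ (Fin n)) :
    fderiv ℝ V x w = ∑ i, w i * fderiv ℝ V x (EuclideanSpace.single i (1 : ℝ)) := by
  classical
  conv_lhs => rw [← (EuclideanSpace.basisFun (Fin n) ℝ).sum_repr w]
  simp only [map_sum, map_smul, EuclideanSpace.basisFun_repr, EuclideanSpace.basisFun_apply, smul_eq_mul]

/-- **THE VIRIAL IDENTITY** (integration by parts against `e^{−V}`, summed over the `d = n` coordinate directions): for `V`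
differentiable with `e^{−V}` integrable, any `x₀`, and the two displayed integrabilities (first moment, and first moment × gradient),
`∫ DV(x)[x − x₀] · e^{−V x} dx = n · ∫ e^{−V}`. [folklore] -/
theorem integral_fderiv_apply_sub_mul_exp_neg {V : EuclideanSpace ℝ (Fin n) → ℝ} (hVd : Differentiable ℝ V)
    (x₀ : EuclideanSpace ℝ (Fin n)) (hZ : Integrable fun x => exp (-V x))
    (hM : Integrable fun x => ‖x - x₀‖ * exp (-V x))
    (hG : Integrable fun x => ‖x - x₀‖ * (‖gradient V x‖ * exp (-V x))) :
    ∫ x, fderiv ℝ V x (x - x₀) * exp (-V x) = n * ∫ x, exp (-V x) := by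
  classical
  set e : Fin n → EuclideanSpace ℝ (Fin n) := fun i => EuclideanSpace.single i (1 : ℝ) with he
  have hne : ∀ i, ‖e i‖ = 1 := fun i => by simp [he]
  have hcoord : ∀ i (w : EuclideanSpace ℝ (Fin n)), ⟪e i, w⟫ = w i := fun i w => by
    simp [he, EuclideanSpace.inner_single_left]
  -- |w_i| ≤ ‖w‖ and |DV(x)[e_i]| ≤ ‖∇V x‖
  have habs : ∀ i (w : EuclideanSpace ℝ (Fin n)), |w i| ≤ ‖w‖ := fun i w => by
    rw [← hcoord]
    simpa [hne] using abs_real_inner_le_norm (e i) w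
  have hDV : ∀ i x, |fderiv ℝ V x (e i)| ≤ ‖gradient V x‖ := fun i x => by
    have h1 : fderiv ℝ V x (e i) = ⟪gradient V x, e i⟫ := by
      rw [gradient, InnerProductSpace.toDual_symm_apply]
    rw [h1]
    simpa [hne] using abs_real_inner_le_norm (gradient V x) (e i)
  -- per-coordinate integrability and identities
  have hA : ∀ i, Integrable fun x => ⟪e i, x - x₀⟫ * exp (-V x) := fun i => by
    refine hM.mono' ?_ (ae_of_all _ fun x => ?_)
    · exact ((continuous_const.inner (continuous_id.sub continuous_const)).mul
        (continuous_exp.comp hVd.continuous.neg)).aestronglyMeasurable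
    · rw [norm_mul, norm_eq_abs, norm_eq_abs, abs_of_pos (exp_pos _), hcoord]
      exact mul_le_mul_of_nonneg_right (habs i _) (exp_pos _).le
  have hB : ∀ i, Integrable fun x => ⟪e i, x - x₀⟫ * (fderiv ℝ V x (e i) * exp (-V x)) := fun i => by
    refine hG.mono' ?_ (ae_of_all _ fun x => ?_)
    · exact ((continuous_const.inner (continuous_id.sub continuous_const)).measurable.mul
        ((measurable_fderiv_apply_const ℝ V (e i)).mul (continuous_exp.comp hVd.continuous.neg).measurable)).aestronglyMeasurable
    · rw [norm_mul, norm_mul, norm_eq_abs, norm_eq_abs, norm_eq_abs, abs_of_pos (exp_pos _), hcoord]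
      exact mul_le_mul (habs i _) (mul_le_mul_of_nonneg_right (hDV i x) (exp_pos _).le)
        (mul_nonneg (abs_nonneg _) (exp_pos _).le) (norm_nonneg _)
  have hI : ∀ i, ∫ x, ⟪e i, x - x₀⟫ * (fderiv ℝ V x (e i) * exp (-V x)) = ∫ x, exp (-V x) := fun i => by
    rw [integral_inner_mul_fderiv_mul_exp_neg hVd x₀ (e i) hZ (hA i) (hB i), hne, one_pow, one_mul]
  -- sum
  have hsum : ∀ x, fderiv ℝ V x (x - x₀) * exp (-V x) = ∑ i, ⟪e i, x - x₀⟫ * (fderiv ℝ V x (e i) * exp (-V x)) := by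
    intro x
    rw [fderiv_apply_eq_sum_coord, Finset.sum_mul]
    refine Finset.sum_congr rfl fun i _ => ?_
    rw [hcoord]; ring
  calc ∫ x, fderiv ℝ V x (x - x₀) * exp (-V x)
      = ∫ x, ∑ i, ⟪e i, x - x₀⟫ * (fderiv ℝ V x (e i) * exp (-V x)) := integral_congr_ae (ae_of_all _ hsum)
    _ = ∑ i, ∫ x, ⟪e i, x - x₀⟫ * (fderiv ℝ V x (e i) * exp (-V x)) := integral_finsetSum _ fun i _ => hB i
    _ = ∑ _i : Fin n, ∫ x, exp (-V x) := Finset.sum_congr rfl fun i _ => hI i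
    _ = n * ∫ x, exp (-V x) := by rw [Finset.sum_const, Finset.card_univ, Fintype.card_fin, nsmul_eq_mul]


/-! ## §3 Strong monotonicity at the critical point and the second-moment bound -/

/-- **STRONG MONOTONICITY AT A CRITICAL POINT** from the road's first-order letter: `∇V x₀ = 0` ⟹ `λ‖x − x₀‖² ≤ DV(x)[x − x₀]`
(add the letter at `(x, x₀)` and at `(x₀, x)`). [folklore] -/
theorem norm_sq_le_fderiv_apply_sub {V : EuclideanSpace ℝ (Fin n) → ℝ} {lam : ℝ} {x₀ : EuclideanSpace ℝ (Fin n)}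
    (hV : ∀ x y : EuclideanSpace ℝ (Fin n), V x + ⟪gradient V x, y - x⟫ + lam / 2 * ‖y - x‖ ^ 2 ≤ V y)
    (hcrit : gradient V x₀ = 0) (x : EuclideanSpace ℝ (Fin n)) : lam * ‖x - x₀‖ ^ 2 ≤ fderiv ℝ V x (x - x₀) := by
  have h1 := hV x x₀
  have h2 := hV x₀ x
  rw [hcrit, inner_zero_left, add_zero] at h2
  have e1 : fderiv ℝ V x (x - x₀) = ⟪gradient V x, x - x₀⟫ := by
    rw [gradient, InnerProductSpace.toDual_symm_apply]
  have e2 : ⟪gradient V x, x₀ - x⟫ = -⟪gradient V x, x - x₀⟫ := by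
    rw [← inner_neg_right, neg_sub]
  rw [norm_sub_rev] at h1
  rw [e1]
  linarith [e2]

/-- **SECOND MOMENT ABOUT THE MINIMISER**: `λ·∫‖x − x₀‖² e^{−V} ≤ n·∫e^{−V}` for `V` differentiable with the first-order
`λ`-convexity letter, `∇V x₀ = 0`, and the displayed integrabilities (mass, first and second moment, first moment × gradient) —
the virial identity + strong monotonicity. [folklore] -/
theorem integral_norm_sq_mul_exp_neg_le {V : EuclideanSpace ℝ (Fin n) → ℝ} {lam : ℝ} {x₀ : EuclideanSpace ℝ (Fin n)}
    (hVd : Differentiable ℝ V)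
    (hV : ∀ x y : EuclideanSpace ℝ (Fin n), V x + ⟪gradient V x, y - x⟫ + lam / 2 * ‖y - x‖ ^ 2 ≤ V y)
    (hcrit : gradient V x₀ = 0) (hZ : Integrable fun x => exp (-V x))
    (hM : Integrable fun x => ‖x - x₀‖ * exp (-V x)) (hM2 : Integrable fun x => ‖x - x₀‖ ^ 2 * exp (-V x))
    (hG : Integrable fun x => ‖x - x₀‖ * (‖gradient V x‖ * exp (-V x))) :
    lam * ∫ x, ‖x - x₀‖ ^ 2 * exp (-V x) ≤ n * ∫ x, exp (-V x) := by
  classical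
  rw [← integral_fderiv_apply_sub_mul_exp_neg hVd x₀ hZ hM hG, ← integral_const_mul]
  -- measurability of `x ↦ DV(x)[x − x₀]` through the coordinate expansion; domination by `‖x − x₀‖·‖∇V x‖·e^{−V}`
  have hmeasD : Measurable fun x : EuclideanSpace ℝ (Fin n) => fderiv ℝ V x (x - x₀) := by
    have e : (fun x : EuclideanSpace ℝ (Fin n) => fderiv ℝ V x (x - x₀)) =
        fun x => ∑ i, (x - x₀) i * fderiv ℝ V x (EuclideanSpace.single i (1 : ℝ)) := by
      funext x; exact fderiv_apply_eq_sum_coord x (x - x₀)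
    rw [e]
    refine Finset.measurable_sum _ fun i _ => Measurable.mul ?_ (measurable_fderiv_apply_const ℝ V _)
    have hc : Continuous fun x : EuclideanSpace ℝ (Fin n) => (x - x₀) i :=
      (EuclideanSpace.proj i).continuous.comp (continuous_id.sub continuous_const)
    exact hc.measurable
  have hGint : Integrable fun x => fderiv ℝ V x (x - x₀) * exp (-V x) := by
    refine hG.mono' (hmeasD.mul (continuous_exp.comp hVd.continuous.neg).measurable).aestronglyMeasurable
      (ae_of_all _ fun x => ?_)
    have e1 : fderiv ℝ V x (x - x₀) = ⟪gradient V x, x - x₀⟫ := by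
      rw [gradient, InnerProductSpace.toDual_symm_apply]
    rw [norm_mul, norm_eq_abs, norm_eq_abs, abs_of_pos (exp_pos _), e1]
    have h1 := abs_real_inner_le_norm (gradient V x) (x - x₀)
    have h2 := exp_pos (-V x)
    nlinarith [norm_nonneg (gradient V x), norm_nonneg (x - x₀)]
  refine integral_mono (hM2.const_mul lam) hGint fun x => ?_
  have h := norm_sq_le_fderiv_apply_sub hV hcrit x
  have h2 := exp_pos (-V x)
  show lam * (‖x - x₀‖ ^ 2 * exp (-V x)) ≤ fderiv ℝ V x (x - x₀) * exp (-V x)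
  nlinarith


/-! ## §4 The centring letter: the tilted mean of a linear functional sits within `‖u‖√(n∕λ)` of its value at the minimiser -/

/-- Cauchy–Schwarz against a non-negative weight: `(∫ a·w)² ≤ (∫ w)·(∫ a²·w)` (the quadratic `t ↦ ∫ (a − t)²·w ≥ 0` has non-positive
discriminant). [folklore] -/
theorem sq_integral_mul_le {α : Type*} [MeasurableSpace α] {μ : Measure α} (a w : α → ℝ) (hw : ∀ x, 0 ≤ w x)
    (hW : Integrable w μ) (h1 : Integrable (fun x => a x * w x) μ) (h2 : Integrable (fun x => a x ^ 2 * w x) μ) :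
    (∫ x, a x * w x ∂μ) ^ 2 ≤ (∫ x, w x ∂μ) * ∫ x, a x ^ 2 * w x ∂μ := by
  have key : ∀ t : ℝ, 0 ≤ (∫ x, w x ∂μ) * (t * t) + (-2 * ∫ x, a x * w x ∂μ) * t + ∫ x, a x ^ 2 * w x ∂μ := by
    intro t
    have hnn : 0 ≤ ∫ x, (a x - t) ^ 2 * w x ∂μ := integral_nonneg fun x => mul_nonneg (sq_nonneg _) (hw x)
    have hexp : ∫ x, (a x - t) ^ 2 * w x ∂μ =
        (∫ x, a x ^ 2 * w x ∂μ) - 2 * t * (∫ x, a x * w x ∂μ) + t ^ 2 * ∫ x, w x ∂μ := by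
      have i1 : ∫ x, (a x - t) ^ 2 * w x ∂μ = ∫ x, (a x ^ 2 * w x - 2 * t * (a x * w x)) + t ^ 2 * w x ∂μ :=
        integral_congr_ae (ae_of_all _ fun x => by simp only; ring)
      have hA : Integrable (fun x => a x ^ 2 * w x - 2 * t * (a x * w x)) μ := h2.sub (h1.const_mul _)
      have hB : Integrable (fun x => t ^ 2 * w x) μ := hW.const_mul _
      have hC : Integrable (fun x => 2 * t * (a x * w x)) μ := h1.const_mul _
      rw [i1, integral_add hA hB, integral_sub h2 hC, integral_const_mul, integral_const_mul]
    rw [hexp] at hnn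
    nlinarith
  have hd := discrim_le_zero key
  rw [discrim] at hd
  nlinarith

/-- **FIRST ABSOLUTE MOMENT ABOUT THE MINIMISER**: `∫‖x − x₀‖e^{−V} ≤ √(n∕λ)·∫e^{−V}` (Cauchy–Schwarz + §3). [folklore] -/
theorem integral_norm_mul_exp_neg_le {V : EuclideanSpace ℝ (Fin n) → ℝ} {lam : ℝ} {x₀ : EuclideanSpace ℝ (Fin n)}
    (hlam : 0 < lam) (hVd : Differentiable ℝ V)
    (hV : ∀ x y : EuclideanSpace ℝ (Fin n), V x + ⟪gradient V x, y - x⟫ + lam / 2 * ‖y - x‖ ^ 2 ≤ V y)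
    (hcrit : gradient V x₀ = 0) (hZ : Integrable fun x => exp (-V x))
    (hM : Integrable fun x => ‖x - x₀‖ * exp (-V x)) (hM2 : Integrable fun x => ‖x - x₀‖ ^ 2 * exp (-V x))
    (hG : Integrable fun x => ‖x - x₀‖ * (‖gradient V x‖ * exp (-V x))) :
    ∫ x, ‖x - x₀‖ * exp (-V x) ≤ Real.sqrt (n / lam) * ∫ x, exp (-V x) := by
  set Z : ℝ := ∫ x, exp (-V x) with hZdef
  set I : ℝ := ∫ x, ‖x - x₀‖ * exp (-V x) with hIdef
  have hZ0 : 0 ≤ Z := integral_nonneg fun x => (exp_pos _).le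
  have hI0 : 0 ≤ I := integral_nonneg fun x => mul_nonneg (norm_nonneg _) (exp_pos _).le
  have hcs := sq_integral_mul_le (μ := volume) (fun x : EuclideanSpace ℝ (Fin n) => ‖x - x₀‖) (fun x => exp (-V x))
    (fun x => (exp_pos _).le) hZ hM hM2
  have hmom := integral_norm_sq_mul_exp_neg_le hVd hV hcrit hZ hM hM2 hG
  -- `I² ≤ Z·∫‖x−x₀‖²e^{−V} ≤ Z·(n∕λ)·Z`
  have hsq : I ^ 2 ≤ (n / lam) * Z ^ 2 := by
    have h2 : ∫ x, ‖x - x₀‖ ^ 2 * exp (-V x) ≤ n / lam * Z := by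
      rw [div_mul_eq_mul_div, le_div_iff₀ hlam]; linarith
    calc I ^ 2 ≤ Z * ∫ x, ‖x - x₀‖ ^ 2 * exp (-V x) := hcs
      _ ≤ Z * (n / lam * Z) := mul_le_mul_of_nonneg_left h2 hZ0
      _ = (n / lam) * Z ^ 2 := by ring
  have hnl : (0 : ℝ) ≤ n / lam := by positivity
  calc I = Real.sqrt (I ^ 2) := (Real.sqrt_sq hI0).symm
    _ ≤ Real.sqrt ((n / lam) * Z ^ 2) := Real.sqrt_le_sqrt hsq
    _ = Real.sqrt (n / lam) * Z := by rw [Real.sqrt_mul hnl, Real.sqrt_sq hZ0]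

/-- **THE CENTRING LETTER IN THE `e^{−V}` CURRENCY**: `|∫⟪u, x − x₀⟫e^{−V}| ≤ ‖u‖·√(n∕λ)·∫e^{−V}`. [folklore] -/
theorem abs_integral_inner_sub_mul_exp_neg_le {V : EuclideanSpace ℝ (Fin n) → ℝ} {lam : ℝ} {x₀ : EuclideanSpace ℝ (Fin n)}
    (hlam : 0 < lam) (hVd : Differentiable ℝ V)
    (hV : ∀ x y : EuclideanSpace ℝ (Fin n), V x + ⟪gradient V x, y - x⟫ + lam / 2 * ‖y - x‖ ^ 2 ≤ V y)
    (hcrit : gradient V x₀ = 0) (hZ : Integrable fun x => exp (-V x))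
    (hM : Integrable fun x => ‖x - x₀‖ * exp (-V x)) (hM2 : Integrable fun x => ‖x - x₀‖ ^ 2 * exp (-V x))
    (hG : Integrable fun x => ‖x - x₀‖ * (‖gradient V x‖ * exp (-V x))) (u : EuclideanSpace ℝ (Fin n)) :
    |∫ x, ⟪u, x - x₀⟫ * exp (-V x)| ≤ ‖u‖ * Real.sqrt (n / lam) * ∫ x, exp (-V x) := by
  have h1 : |∫ x, ⟪u, x - x₀⟫ * exp (-V x)| ≤ ∫ x, ‖u‖ * (‖x - x₀‖ * exp (-V x)) := by
    refine (abs_integral_le_integral_abs).trans (integral_mono_of_nonneg (ae_of_all _ fun x => abs_nonneg _)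
      (hM.const_mul ‖u‖) (ae_of_all _ fun x => ?_))
    show |⟪u, x - x₀⟫ * exp (-V x)| ≤ ‖u‖ * (‖x - x₀‖ * exp (-V x))
    rw [abs_mul, abs_of_pos (exp_pos _), ← mul_assoc]
    exact mul_le_mul_of_nonneg_right (abs_real_inner_le_norm u (x - x₀)) (exp_pos _).le
  rw [integral_const_mul] at h1
  have h2 := integral_norm_mul_exp_neg_le hlam hVd hV hcrit hZ hM hM2 hG
  calc |∫ x, ⟪u, x - x₀⟫ * exp (-V x)| ≤ ‖u‖ * ∫ x, ‖x - x₀‖ * exp (-V x) := h1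
    _ ≤ ‖u‖ * (Real.sqrt (n / lam) * ∫ x, exp (-V x)) := mul_le_mul_of_nonneg_left h2 (norm_nonneg _)
    _ = ‖u‖ * Real.sqrt (n / lam) * ∫ x, exp (-V x) := by ring

/-- **THE TILTED MEAN MINUS ITS VALUE AT `x₀`, AS ONE INTEGRAL**: for `ν_V = e^{−V}dx∕∫e^{−V}`,
`∫⟪u, x⟫dν_V − ⟪u, x₀⟫ = (∫⟪u, x − x₀⟫e^{−V}) ∕ ∫e^{−V}` (`integral_tilted`). [folklore] -/
theorem tiltedMean_inner_sub_eq {V : EuclideanSpace ℝ (Fin n) → ℝ} (x₀ u : EuclideanSpace ℝ (Fin n))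
    (hZ : Integrable fun x => exp (-V x)) (hM : Integrable fun x => ‖x - x₀‖ * exp (-V x)) (hVm : Measurable V) :
    ∫ x, ⟪u, x⟫ ∂(volume.tilted fun x => -V x) - ⟪u, x₀⟫ =
      (∫ x, ⟪u, x - x₀⟫ * exp (-V x)) / ∫ x, exp (-V x) := by
  set Z : ℝ := ∫ x, exp (-V x) with hZdef
  have hZpos : 0 < Z := integral_exp_pos hZ
  have hI : Integrable fun x => ⟪u, x - x₀⟫ * exp (-V x) := by
    refine (hM.const_mul ‖u‖).mono' ?_ (ae_of_all _ fun x => ?_)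
    · exact ((continuous_const.inner (continuous_id.sub continuous_const)).measurable.mul
        (continuous_exp.measurable.comp hVm.neg)).aestronglyMeasurable
    · rw [norm_mul, norm_eq_abs, norm_eq_abs, abs_of_pos (exp_pos _), ← mul_assoc]
      exact mul_le_mul_of_nonneg_right (abs_real_inner_le_norm u (x - x₀)) (exp_pos _).le
  rw [integral_tilted]
  have e : (fun x : EuclideanSpace ℝ (Fin n) => (exp (-V x) / ∫ y, exp (-V y)) • ⟪u, x⟫) =
      fun x => Z⁻¹ * (⟪u, x - x₀⟫ * exp (-V x)) + (⟪u, x₀⟫ * Z⁻¹) * exp (-V x) := by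
    funext x
    rw [smul_eq_mul, inner_sub_right, ← hZdef]
    field_simp
    ring
  rw [e, integral_add (hI.const_mul _) (hZ.const_mul _), integral_const_mul, integral_const_mul, ← hZdef]
  field_simp
  ring

/-- **THE CENTRING LETTER** (PRICING-NE7b v80 F428: «`|⟪u_i, mean − x₀⟫| ≤ (𝔼‖x − x₀‖²)^{½} ≤ √(d∕λ)` for `x₀` the minimiser of V —
integrate `⟪∇V(x) − ∇V(x₀), x − x₀⟫ ≥ λ‖x − x₀‖²` against `e^{−V}`: `𝔼⟪∇V(x), x − x₀⟫ = d` by parts»): for `V` differentiable with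
the road's first-order `λ`-convexity letter (`λ > 0`), `∇V x₀ = 0`, `e^{−V}` integrable and the displayed moment integrabilities, the
tilted mean of every linear functional is within `‖u‖·√(n∕λ)` of its value at the minimiser:
`|∫⟪u, x⟫ dν_V − ⟪u, x₀⟫| ≤ ‖u‖·√(n∕λ)`, `ν_V = e^{−V}dx∕∫e^{−V}` on `EuclideanSpace ℝ (Fin n)`. [folklore] -/
theorem abs_tiltedMean_inner_sub_le {V : EuclideanSpace ℝ (Fin n) → ℝ} {lam : ℝ} {x₀ : EuclideanSpace ℝ (Fin n)}
    (hlam : 0 < lam) (hVd : Differentiable ℝ V)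
    (hV : ∀ x y : EuclideanSpace ℝ (Fin n), V x + ⟪gradient V x, y - x⟫ + lam / 2 * ‖y - x‖ ^ 2 ≤ V y)
    (hcrit : gradient V x₀ = 0) (hZ : Integrable fun x => exp (-V x))
    (hM : Integrable fun x => ‖x - x₀‖ * exp (-V x)) (hM2 : Integrable fun x => ‖x - x₀‖ ^ 2 * exp (-V x))
    (hG : Integrable fun x => ‖x - x₀‖ * (‖gradient V x‖ * exp (-V x))) (u : EuclideanSpace ℝ (Fin n)) :
    |∫ x, ⟪u, x⟫ ∂(volume.tilted fun x => -V x) - ⟪u, x₀⟫| ≤ ‖u‖ * Real.sqrt (n / lam) := by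
  have hZpos : 0 < ∫ x, exp (-V x) := integral_exp_pos hZ
  rw [tiltedMean_inner_sub_eq x₀ u hZ hM hVd.continuous.measurable, abs_div, abs_of_pos hZpos, div_le_iff₀ hZpos]
  exact abs_integral_inner_sub_mul_exp_neg_le hlam hVd hV hcrit hZ hM hM2 hG u


end Summit.QuantumFields.BalabanUV.T4Continuum.NE7b.TiltedMeanNearMinimiser

end
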